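import Mathlib
import HarnessLib
import Literature.MathematicalPhysics.KineticTheory.HardSphereEuler
import Literature.MathematicalPhysics.KineticTheory.BackwardCluster
import Summits.AtomisticToContinuum.HydrodynamicLimit.Theses.RelayRaceLocality

/-!
# Crux `RelayRaceLocality.GibbsLightCone` (stmt-AtomisticToContinuum-12501) — ideator 4, round 2:
first lemma and transferred target of the card `hitter-forest-renewal` (statements only, plus one
PROVED abstract renewal lemma that is the algebraic closure step of the card).
-/

namespace Summit.AtomisticToContinuum.HydrodynamicLimit.Cruxes.GibbsLightCone.IdeatorFour

open Literature.Analysis.FluidPDE Literature.MathematicalPhysics.KineticTheory MeasureTheory Filter Set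
open scoped ENNReal BigOperators

/-- Kinetic length unit `ℓ_N = (N+1)^{-1/3} / σ²` and mean free time `τ_N = ℓ_N / √θ` (as in `Seams.lean`). -/
noncomputable def ell (σ : ℝ) (N : ℕ) : ℝ := (((N + 1 : ℕ) : ℝ) ^ (-(1 / 3 : ℝ))) / σ ^ 2

noncomputable def tau (σ θ : ℝ) (N : ℕ) : ℝ := ell σ N / Real.sqrt θ

/-- FIRST LEMMA (`OneWindowJointDeflection`, Lanford-short, L/XL formalisation, mathematically inside
Lanford's radius): under the invariant Gibbs law, for a window `Δ ≤ c₀ τ_N` and any `m ≤ K log(N+2)`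
DISTINCT tagged spheres, the probability that EVERY one of them undergoes at least one collision during
`(0, Δ]` (equivalently: has a nonempty APST backward cluster over `(0, Δ]`) is at most `(C Δ/τ_N)^m`,
eventually in `N`. It is the product ("forest") form of the one-window Campbell bound: `m` prescribed
roots, each needing a creation or an internal collision inside one Lanford window; coincidences (shared
deflector, mutual collision of two tagged spheres) are `O(m²/N)`-suppressed, whence `∀ᶠ N`. -/
def OneWindowJointDeflection : Prop :=
  ∀ a θ : ℝ, 0 < a → 0 < θ → ∃ σ₀ : ℝ, 0 < σ₀ ∧ ∃ C c₀ : ℝ, 0 < C ∧ 0 < c₀ ∧ ∀ K : ℝ, 0 < K →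
    ∀ σ : ℝ, 0 < σ → σ < σ₀ →
    ∀ Φ : (N : ℕ) → HardSphereFlow (Torus.geometry (Fin 3)) (hsDiameter σ N) (N + 1),
    ∀ᶠ N : ℕ in atTop, ∀ Δ : ℝ, 0 < Δ → Δ ≤ c₀ * tau σ θ N →
      ∀ (m : ℕ) (q : Fin m → Fin (N + 1)), (m : ℝ) ≤ K * Real.log ((N : ℝ) + 2) →
        Function.Injective q →
        localGibbsLaw σ (fun _ => a) (fun _ => 0) (fun _ => θ) N (Φ N)
            {z | ∀ i : Fin m, ((Φ N).backwardCluster (q i) 0 Δ z).Nonempty}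
          ≤ ENNReal.ofReal ((C * Δ / tau σ θ N) ^ m)

/-- TRANSFERRED TARGET, minimal instance (`HotFlightDampingBC` = D2, the `n = 0` slice of seam Y″ in
backward-cluster form): a tagged sphere faster than `A√θ` flies collision-free over a path of `y ℓ_N`
with probability `≤ C e^{-η y}`, for `1 ≤ y ≤ K log(N+2)`, eventually in `N`; constants fixed before
`σ`. (`backwardCluster 0 0 T z = ∅` is "sphere 0 has no collision during (0, T]".) False without
`0 < σ` (`hotFlightDamping_false_without_posDiameter`, p133876), as it must be. -/
def HotFlightDampingBC : Prop :=
  ∀ a θ : ℝ, 0 < a → 0 < θ → ∃ σ₀ : ℝ, 0 < σ₀ ∧ ∃ A η C : ℝ, 0 < A ∧ 0 < η ∧ 0 < C ∧ ∀ K : ℝ, 0 < K →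
    ∀ σ : ℝ, 0 < σ → σ < σ₀ →
    ∀ Φ : (N : ℕ) → HardSphereFlow (Torus.geometry (Fin 3)) (hsDiameter σ N) (N + 1),
    ∀ᶠ N : ℕ in atTop, ∀ y : ℝ, 1 ≤ y → y ≤ K * Real.log ((N : ℝ) + 2) → ∀ T : ℝ, 0 < T →
      localGibbsLaw σ (fun _ => a) (fun _ => 0) (fun _ => θ) N (Φ N)
          {z | (Φ N).backwardCluster 0 0 T z = ∅ ∧ A * Real.sqrt θ < ‖(z 0).2‖ ∧
               y * ell σ N < ‖(z 0).2‖ * T}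
        ≤ ENNReal.ofReal (C * Real.exp (-η * y))

/-- CLOSURE STEP (abstract discrete renewal / Gronwall lemma, PROVED): if a nonnegative sequence obeys
`u n ≤ A rⁿ + Σ_{m<n} κ (n-m) · u m` and the feedback is subcritical against the target rate,
`Σ_{k≤n} κ k · r^{-k} ≤ 1/2` for all `n`, then `u n ≤ 2 A rⁿ`. In the card: `u n` = survival over `n`
supersonic pieces, `r = (C c₀)^{c s c₀}` the one-piece forest bound, `κ k` = probability that a carrier
at speed `≥ s/2` bridges `k` pieces (itself `≤` a long hot survival or an aligned one-window relay). -/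
theorem renewal_decay (u κ : ℕ → ℝ) (A r : ℝ) (hA : 0 ≤ A) (hr : 0 < r)
    (hκ0 : ∀ k, 0 ≤ κ k)
    (hsub : ∀ n, ∑ k ∈ Finset.range (n + 1), κ k * r⁻¹ ^ k ≤ 1 / 2)
    (hrec : ∀ n, u n ≤ A * r ^ n + ∑ m ∈ Finset.range n, κ (n - m) * u m) :
    ∀ n, u n ≤ 2 * A * r ^ n := by
  intro n
  induction n using Nat.strong_induction_on with
  | _ n ih =>
    have hstep : ∑ m ∈ Finset.range n, κ (n - m) * u m ≤ A * r ^ n := by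
      calc ∑ m ∈ Finset.range n, κ (n - m) * u m
          ≤ ∑ m ∈ Finset.range n, κ (n - m) * (2 * A * r ^ m) := by
            apply Finset.sum_le_sum
            intro m hm
            have hm' : m < n := Finset.mem_range.mp hm
            exact mul_le_mul_of_nonneg_left (ih m hm') (hκ0 _)
        _ = 2 * A * r ^ n * ∑ m ∈ Finset.range n, κ (n - m) * r⁻¹ ^ (n - m) := by
            rw [Finset.mul_sum]
            apply Finset.sum_congr rfl
            intro m hm
            have hm' : m < n := Finset.mem_range.mp hm
            have hsplit : r ^ n = r ^ m * r ^ (n - m) := by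
              rw [← pow_add]; congr 1; omega
            rw [hsplit, inv_pow]
            have hrnm : r ^ (n - m) ≠ 0 := pow_ne_zero _ hr.ne'
            field_simp
        _ ≤ 2 * A * r ^ n * (1 / 2) := by
            apply mul_le_mul_of_nonneg_left _ (by positivity)
            calc ∑ m ∈ Finset.range n, κ (n - m) * r⁻¹ ^ (n - m)
                ≤ ∑ k ∈ Finset.range (n + 1), κ k * r⁻¹ ^ k := by
                  -- reindex m ↦ n - m (injective on range n, lands in range (n+1))
                  have hinj : Set.InjOn (fun m => n - m) (Finset.range n : Set ℕ) := by
                    intro x hx y hy hxy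
                    have hx' : x < n := Finset.mem_range.mp hx
                    have hy' : y < n := Finset.mem_range.mp hy
                    simp only at hxy
                    omega
                  calc ∑ m ∈ Finset.range n, κ (n - m) * r⁻¹ ^ (n - m)
                      = ∑ k ∈ (Finset.range n).image (fun m => n - m), κ k * r⁻¹ ^ k := by
                        rw [Finset.sum_image hinj]
                    _ ≤ ∑ k ∈ Finset.range (n + 1), κ k * r⁻¹ ^ k := by
                        apply Finset.sum_le_sum_of_subset_of_nonneg
                        · intro k hk
                          simp only [Finset.mem_image, Finset.mem_range] at hk ⊢
                          obtain ⟨m, hm, rfl⟩ := hk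
                          omega
                        · intro k _ _
                          exact mul_nonneg (hκ0 k) (pow_nonneg (inv_nonneg.mpr hr.le) k)
              _ ≤ 1 / 2 := hsub n
        _ = A * r ^ n := by ring
    calc u n ≤ A * r ^ n + ∑ m ∈ Finset.range n, κ (n - m) * u m := hrec n
      _ ≤ A * r ^ n + A * r ^ n := by linarith
      _ = 2 * A * r ^ n := by ring

end Summit.AtomisticToContinuum.HydrodynamicLimit.Cruxes.GibbsLightCone.IdeatorFour
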